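import Summits.RiemannHypothesis.RiemannHypothesis.Theorems.Splittings.RobinFiniteStairRangesHigh
import Summits.RiemannHypothesis.RiemannHypothesis.Theorems.Splittings.RobinFiniteSqrtWindowCover
import HarnessLib

/-!
# RobinFiniteStairSqrt — g18 «THE WHOLE STAIRCASE», composition add-on 1/2 (parts 1–9 = lane (ix-n) «STAIRCASE»)

COMPOSITION with the tree's `√`-window budgets `b'_k` (`RobinFiniteSqrtWindowCover.key_ineq_levelS`, lane (ix-j)): the two lifts are
independent and ADD — `key_ineq_level3S` (`b' ≤ b'_k + d_k = 0.301, 0.402, 0.458, 0.502, 0.535, 0.562, 0.583`), `tolStS`,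
`level3S_of_tolStS`, the composed law `robinCA_below_stairS` (`robinCA_below_stair_of` with `β = bkS`, window from Büthe 2018 via
`thetaWindow_ofB` — modulo {Büthe 2018 Thm 2, BKLNW 2021} ONLY, no Büthe 2016) and its rows `10⁵ ⟹ robinCA_below 583000001`, `1.4·10⁵ ⟹
4¹⁵`, `2.75·10⁵ ⟹ 4¹⁶`, `5.5·10⁵ ⟹ 4¹⁷`, `1.105·10⁶ ⟹ 4¹⁸`, `2·10⁵ ⟹ 2400000001`, `3·10⁵ ⟹ 5700000001`, `5·10⁵ ⟹ 14600000001`, `10⁶ ⟹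
57200000001`, `robin_le_of_rh550000_stairS : RH(5.5·10⁵) ⟹ ∀ n, 5040 < n → n ≤ 10^(7·10⁹) → robinInequality n` (standard axioms).

Cell rh-split, seat rh-split-robin-finite g18 (brief sha16 f79c5f09d8bcb036), card `cards/SPLIT-robin-finite.md` §25; carved VERBATIM from the
kernel-checked object `HOME/rh-split-robin-finite/g18/SketchG18.lean` (sha16 71a1ab953989b3a4; `lean check` rc 0, 0 warnings, 0 sorries).  Zero `instance`,
zero `notation`, no attribute changes, no `native_decide` in this file; no `def … : Prop`; every conjecture / print fact appears only as an explicit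
hypothesis (`Buthe2016_thm2`, `Buthe2018_thm2_theta`, `BroadbentEtAl2021_theta_rel_1e19`, `RiemannHypothesisUpTo T`).

THE LINE.  A colossally abundant `N = ∏ p^{a_p}` with largest prime `P` and structure prime `Q` (largest prime of exponent `≥ 2`) satisfies not
only `log N ≥ θ(P) + θ(Q)` (the tree) but `log N ≥ θ(P) + θ(Q) + Λ` with `Λ = Σ_{j≥3} θ(x_j)` the higher storeys of the Alaoglu–Erdős staircase;
`Λ_K` is certified per dyadic piece `2^K ≤ P < 2^{K+1}` and spent on the analytic side as EXTRA zero-tail budget `d_k` on top of the tree's level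
budgets `b_k` (`E_b` is affine in `b`; the gain `G₁^Λ − G₁` pays `d_k·w(P)`), so the SAME verified height `T` certifies a LONGER range of CA primes; the shift is
generic in its base (`key_ineq_shift`, part 5) and composes with the tree's `√`-window budgets `b'_k` (composition add-on, 2 files).

HONEST LABEL: «SPLITTING SEARCH over kernel-typed RH-EQUIVALENCES; a splitting A ∧ B ⟹ RH is CONDITIONAL bookkeeping unless A and B
are both proved; nothing here bears on the truth of RH.»
-/

set_option linter.dupNamespace false

noncomputable section

open Real Finset
open scoped ArithmeticFunction.sigma Chebyshev

namespace Summit.RiemannHypothesis.RiemannHypothesis.Theorems.Splittings.RobinFiniteC1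

section StaircaseSqrt

open Literature.NumberTheory.LFunctions Literature.NumberTheory.DiophantineGeometry
open RobinAnalyticSharp RobinAnalyticSharp.Cells
open Summit.RiemannHypothesis.RiemannHypothesis.Theorems.Splittings.RobinFiniteE3
open Summit.RiemannHypothesis.RiemannHypothesis.Theorems.Splittings.RobinFiniteTail

/-! ### E · COMPOSITION with the `√`-window budgets `b'_k` (tree `RobinFiniteSqrtWindowCover.key_ineq_levelS`, lane (ix-j))

The two lifts of the level budgets are INDEPENDENT and ADD.  The `√`-window cover certificates (Büthe 2018 Thm 2 boxes,
`coverS11_ok … coverS17_ok`) lift the BASE `b_k ↦ b'_k = 0.208, 0.332, 0.405, 0.461, 0.504, 0.538, 0.564`; the staircase shift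
(`key_ineq_shift`) adds `d_k` on top of ANY base.  Composed budgets `b'_k + d_k = 0.301, 0.402, 0.458, 0.502, 0.535, 0.562, 0.583`
(`k = 11 … 17`), same reflection-paired tail charge, same law `robinCA_below_stair_of`. -/

/-- **E1 · the shifted level inequality on the `√`-window budgets**: `E_{b'}(P) < G₂ + G₁^Λ` for every `b' ≤ b'_k + d_k`,
`4ᵏ ≤ P ≤ 4ᵏ⁺¹`, `Q ≤ P`, `Q < 4√P + 4` (`key_ineq_shift` over the tree's `key_ineq_levelS`: Büthe 2018 Thm 2 for the base, the
RH-type window `hW` for the shift). -/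
theorem key_ineq_level3S (hB : Buthe2018_thm2_theta) {B : ℝ}
    (hW : (∀ y : ℝ, 599 ≤ y → y ≤ B → |θ y - y| ≤ √y * Real.log y ^ 2 / (8 * π)))
    {k : ℕ} (hk11 : 11 ≤ k) (hk17 : k ≤ 17) {P Q : ℕ} (hPl : 4 ^ k ≤ P) (hPu : P ≤ 4 ^ (k + 1))
    (hPB : (P : ℝ) ≤ B) (hQP : Q ≤ P) (hQs : (Q : ℝ) < 4 * √(P : ℝ) + 4) {b' : ℝ}
    (hb' : b' ≤ ((bkS k : ℚ) : ℝ) + ((dk k : ℚ) : ℝ)) :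
    (nicolasERH P + (b' - nicolasBeta) * (1 / (√P * Real.log P) + 1 / (√P * Real.log P ^ 2) + 4 / (√P * Real.log P ^ 3))) <
      ∑ p ∈ (Nat.primesLE P).filter (fun p => Q < p), ((p : ℝ) ^ 2)⁻¹ +
        (θ Q + ((lamQ (pieceK k P) : ℚ) : ℝ)) /
          ((θ P + (θ Q + ((lamQ (pieceK k P) : ℚ) : ℝ))) * Real.log (θ P + (θ Q + ((lamQ (pieceK k P) : ℚ) : ℝ)))) :=
  key_ineq_shift hW hk11 hk17 hPl hPu hPB hQs (key_ineq_levelS hB hk11 hk17 hPl hPu hQP le_rfl) hb'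

/-- Tolerances for a FULL level on the composed budgets: `tolStS k = ⌊(b'_k + d_k − 0.0463)/((1 + 2/L1 k)(2ᵏ⁺¹ + 2⁻ᵏ⁻¹)/2)⌋₁ₑ₋₉`
(`1.09945e-4, 7.752e-5, 4.5236e-5, 2.5215e-5, 1.3605e-5, 7.218e-6, 3.774e-6`; the tree's `b_k`-tolerances `tolR`: `2.533e-5 … 3.19e-6`). -/
def tolStS : ℕ → ℚ
  | 11 => 109945 / 10 ^ 9 | 12 => 77520 / 10 ^ 9 | 13 => 45236 / 10 ^ 9 | 14 => 25215 / 10 ^ 9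
  | 15 => 13605 / 10 ^ 9 | 16 => 7218 / 10 ^ 9 | 17 => 3774 / 10 ^ 9 | _ => 0

/-- The composed level condition from the tolerance table `tolStS` (full levels: `√X = 2ᵏ⁺¹`). -/
theorem level3S_of_tolStS {t : ℝ} {k : ℕ} (hk11 : 11 ≤ k) (hk17 : k ≤ 17) (ht : t ≤ ((tolStS k : ℚ) : ℝ)) :
    0.0463 + (1 + 2 / ((L1 k : ℚ) : ℝ)) * (t * (((2 : ℝ) ^ (k + 1) + ((2 : ℝ) ^ (k + 1))⁻¹) / 2)) ≤
      ((bkS k : ℚ) : ℝ) + ((dk k : ℚ) : ℝ) := by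
  interval_cases k <;>
    · simp only [tolStS, bkS, dk, L1, l2] at ht ⊢; push_cast at ht ⊢; norm_num at ht ⊢; nlinarith [ht]

open scoped ArithmeticFunction.sigma in
/-- **E2 · THE COMPOSED LAW.**  RH verified to ANY height `T ≥ 10⁵` + {Büthe 2018 Thm 2, BKLNW 2021} ⟹ Robin's
inequality at every colossally abundant `N > 5040` all of whose primes are `≤ X` (`X < 4¹⁸`), provided every FULL level `4ᵏ⁺¹ ≤ X`
has `tailH(T) ≤ tolStS k` and the TOP level `4ᵏ ≤ X < 4ᵏ⁺¹` passes `0.0463 + (1 + 2/L1 k)·tailH(T)·(√X + 1/√X)/2 ≤ b'_k + d_k`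
(`robinCA_below_stair_of` with `β = bkS`: base `key_ineq_levelS`, shift `key_ineq_shift`, CA side `theta_add_theta_add_lam_le_log`,
`structureQ_lt`).  No conjecture in hypothesis position; nothing here bears on the truth of RH. -/
theorem robinCA_below_stairS (hB : Buthe2018_thm2_theta)
    (hK : BroadbentEtAl2021_theta_rel_1e19) {T : ℝ} (hT : 100000 ≤ T) (hRH : RiemannHypothesisUpTo T) {X : ℕ}
    (hX18 : (X : ℝ) < (4 : ℝ) ^ 18)
    (hfull : ∀ k : ℕ, 11 ≤ k → k ≤ 17 → (4 : ℝ) ^ (k + 1) ≤ (X : ℝ) →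
      ((Real.log (T / (2 * π)) + 1) / (π * T) + (184 + 30 * Real.log T) / T ^ 2) ≤ ((tolStS k : ℚ) : ℝ))
    (htop : ∀ k : ℕ, 11 ≤ k → k ≤ 17 → (4 : ℝ) ^ k ≤ (X : ℝ) → (X : ℝ) < (4 : ℝ) ^ (k + 1) →
      0.0463 + (1 + 2 / ((L1 k : ℚ) : ℝ)) *
        (((Real.log (T / (2 * π)) + 1) / (π * T) + (184 + 30 * Real.log T) / T ^ 2) * ((√(X : ℝ) + (√(X : ℝ))⁻¹) / 2)) ≤
        ((bkS k : ℚ) : ℝ) + ((dk k : ℚ) : ℝ)) :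
    robinCA_below (X + 1) :=
  robinCA_below_stair_of (β := bkS) (tol := tolStS)
    (fun hW _ hk11 hk17 _ _ hPl hPu hPB hQP hQs _ hb' => key_ineq_level3S hB hW hk11 hk17 hPl hPu hPB hQP hQs hb')
    (fun _ _ hk11 hk17 ht => level3S_of_tolStS hk11 hk17 ht) hB hK hT hRH hX18
    (fun _ y hy hyX => thetaWindow_ofB hB y hy (hyX.trans (hX18.le.trans (by norm_num)))) hfull htop

/-! ### E′ · rows of the composed law (`tailH` numerics as in Part D; `tailH_500000_le`, `tailH_1000000_le` reused) -/

/-- **ROW SA · `RH(T)`, any `T ≥ 100 000`, + the two θ-prints ⟹ Robin at every CA `N > 5040` with all primes `< ``583 000 001`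
(composed budgets `b'_k + d_k`; `X = 583 000 000`; `b_k + d_k` alone (Part D): `2.5·10⁸`; `b'_k` alone ((ix-k) `robinCA_below_483e6_of_rh100000R`): `4.83·10⁸`; tree `b_k`: primes `< 4¹¹` + nothing). -/
theorem robinCA_below_stairS_100000 (hB : Buthe2018_thm2_theta)
    (hK : BroadbentEtAl2021_theta_rel_1e19) {T : ℝ} (hT : 100000 ≤ T) (hRH : RiemannHypothesisUpTo T) :
    robinCA_below 583000001 := by
  have hT5 : (100000 : ℝ) ≤ T := le_trans (by norm_num) hT
  have ht0 := tailH_nonneg (show (7 : ℝ) ≤ T by linarith)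
  have ht := (tailH_anti (by norm_num) hT).trans tailH_1e5_le
  show robinCA_below (583000000 + 1)
  refine robinCA_below_stairS hB hK hT5 hRH (X := 583000000) (by norm_num) (fun k hk11 hk17 hfl => ?_)
    (fun k hk11 hk17 hkl hku => ?_)
  · interval_cases k <;> first
      | (exfalso; norm_num at hfl; done)
      | (refine ht.trans ?_; simp only [tolStS]; push_cast; norm_num)
  · interval_cases k <;> first
      | (exfalso; norm_num at hkl hku; done)
      | exact top_of_num ht0 ht (by norm_num) (s := 24146) (by norm_num) (by norm_num)
          (by simp only [L1, l2]; push_cast; norm_num) (by simp only [L1, l2, bkS, dk]; push_cast; norm_num)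

/-- `tailH(140000) ≤ 2.50831e-5`. -/
theorem tailH_140000_le :
    (Real.log (140000 / (2 * π)) + 1) / (π * 140000) + (184 + 30 * Real.log 140000) / 140000 ^ 2 ≤ 2.50831e-5 := by
  have ha := log_div_two_pi_le_num (T₀ := 140000) (by norm_num) 10 (x := 2e-4) (by norm_num) (by norm_num)
  have hb := log_le_num (T₀ := 140000) (by norm_num) 11 (x := 0.0086) (by norm_num) (by norm_num)
  refine (tailH_le_num (T₀ := 140000) (by norm_num) ha hb (by norm_num)).trans ?_
  norm_num

/-- **ROW S15 · `RH(T)`, any `T ≥ 140 000`, + the two θ-prints ⟹ Robin at every CA `N > 5040` with all primes `< ``4^15`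
(composed budgets `b'_k + d_k`; `X = 4^15 − 1`; `4¹⁵`: Part D `1.8·10⁵`, (ix-k) `1.81·10⁵`, tree `3.3·10⁵`). -/
theorem robinCA_below_stairS_140000 (hB : Buthe2018_thm2_theta)
    (hK : BroadbentEtAl2021_theta_rel_1e19) {T : ℝ} (hT : 140000 ≤ T) (hRH : RiemannHypothesisUpTo T) :
    robinCA_below 1073741824 := by
  have hT5 : (100000 : ℝ) ≤ T := le_trans (by norm_num) hT
  have ht0 := tailH_nonneg (show (7 : ℝ) ≤ T by linarith)
  have ht := (tailH_anti (by norm_num) hT).trans tailH_140000_le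
  show robinCA_below (1073741823 + 1)
  refine robinCA_below_stairS hB hK hT5 hRH (X := 1073741823) (by norm_num) (fun k hk11 hk17 hfl => ?_)
    (fun k hk11 hk17 hkl hku => ?_)
  · interval_cases k <;> first
      | (exfalso; norm_num at hfl; done)
      | (refine ht.trans ?_; simp only [tolStS]; push_cast; norm_num)
  · interval_cases k <;> first
      | (exfalso; norm_num at hkl hku; done)
      | exact top_of_num ht0 ht (by norm_num) (s := 32768) (by norm_num) (by norm_num)
          (by simp only [L1, l2]; push_cast; norm_num) (by simp only [L1, l2, bkS, dk]; push_cast; norm_num)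

/-- `tailH(275000) ≤ 1.35385e-5`. -/
theorem tailH_275000_le :
    (Real.log (275000 / (2 * π)) + 1) / (π * 275000) + (184 + 30 * Real.log 275000) / 275000 ^ 2 ≤ 1.35385e-5 := by
  have ha := log_div_two_pi_le_num (T₀ := 275000) (by norm_num) 10 (x := 0.0069) (by norm_num) (by norm_num)
  have hb := log_le_num (T₀ := 275000) (by norm_num) 12 (x := 0.0053) (by norm_num) (by norm_num)
  refine (tailH_le_num (T₀ := 275000) (by norm_num) ha hb (by norm_num)).trans ?_
  norm_num

/-- **ROW S16 · `RH(T)`, any `T ≥ 275 000`, + the two θ-prints ⟹ Robin at every CA `N > 5040` with all primes `< ``4^16`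
(composed budgets `b'_k + d_k`; `X = 4^16 − 1`; `4¹⁶`: Part D `3.4·10⁵`, (ix-k) `3.25·10⁵`, tree `5·10⁵`). -/
theorem robinCA_below_stairS_275000 (hB : Buthe2018_thm2_theta)
    (hK : BroadbentEtAl2021_theta_rel_1e19) {T : ℝ} (hT : 275000 ≤ T) (hRH : RiemannHypothesisUpTo T) :
    robinCA_below 4294967296 := by
  have hT5 : (100000 : ℝ) ≤ T := le_trans (by norm_num) hT
  have ht0 := tailH_nonneg (show (7 : ℝ) ≤ T by linarith)
  have ht := (tailH_anti (by norm_num) hT).trans tailH_275000_le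
  show robinCA_below (4294967295 + 1)
  refine robinCA_below_stairS hB hK hT5 hRH (X := 4294967295) (by norm_num) (fun k hk11 hk17 hfl => ?_)
    (fun k hk11 hk17 hkl hku => ?_)
  · interval_cases k <;> first
      | (exfalso; norm_num at hfl; done)
      | (refine ht.trans ?_; simp only [tolStS]; push_cast; norm_num)
  · interval_cases k <;> first
      | (exfalso; norm_num at hkl hku; done)
      | exact top_of_num ht0 ht (by norm_num) (s := 65536) (by norm_num) (by norm_num)
          (by simp only [L1, l2]; push_cast; norm_num) (by simp only [L1, l2, bkS, dk]; push_cast; norm_num)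

/-- `tailH(550000) ≤ 7.1726e-6`. -/
theorem tailH_550000_le :
    (Real.log (550000 / (2 * π)) + 1) / (π * 550000) + (184 + 30 * Real.log 550000) / 550000 ^ 2 ≤ 7.1726e-6 := by
  have ha := log_div_two_pi_le_num (T₀ := 550000) (by norm_num) 11 (x := 0.0039) (by norm_num) (by norm_num)
  have hb := log_le_num (T₀ := 550000) (by norm_num) 13 (x := 0.0022) (by norm_num) (by norm_num)
  refine (tailH_le_num (T₀ := 550000) (by norm_num) ha hb (by norm_num)).trans ?_
  norm_num

/-- **ROW S17 · `RH(T)`, any `T ≥ 550 000`, + the two θ-prints ⟹ Robin at every CA `N > 5040` with all primes `< ``4^17`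
(composed budgets `b'_k + d_k`; `X = 4^17 − 1`; `4¹⁷`: Part D `6.4·10⁵`, (ix-k) `6.48·10⁵`, tree `8.6·10⁵`). -/
theorem robinCA_below_stairS_550000 (hB : Buthe2018_thm2_theta)
    (hK : BroadbentEtAl2021_theta_rel_1e19) {T : ℝ} (hT : 550000 ≤ T) (hRH : RiemannHypothesisUpTo T) :
    robinCA_below 17179869184 := by
  have hT5 : (100000 : ℝ) ≤ T := le_trans (by norm_num) hT
  have ht0 := tailH_nonneg (show (7 : ℝ) ≤ T by linarith)
  have ht := (tailH_anti (by norm_num) hT).trans tailH_550000_le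
  show robinCA_below (17179869183 + 1)
  refine robinCA_below_stairS hB hK hT5 hRH (X := 17179869183) (by norm_num) (fun k hk11 hk17 hfl => ?_)
    (fun k hk11 hk17 hkl hku => ?_)
  · interval_cases k <;> first
      | (exfalso; norm_num at hfl; done)
      | (refine ht.trans ?_; simp only [tolStS]; push_cast; norm_num)
  · interval_cases k <;> first
      | (exfalso; norm_num at hkl hku; done)
      | exact top_of_num ht0 ht (by norm_num) (s := 131072) (by norm_num) (by norm_num)
          (by simp only [L1, l2]; push_cast; norm_num) (by simp only [L1, l2, bkS, dk]; push_cast; norm_num)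

/-- `tailH(1105000) ≤ 3.7684e-6`. -/
theorem tailH_1105000_le :
    (Real.log (1105000 / (2 * π)) + 1) / (π * 1105000) + (184 + 30 * Real.log 1105000) / 1105000 ^ 2 ≤ 3.7684e-6 := by
  have ha := log_div_two_pi_le_num (T₀ := 1105000) (by norm_num) 12 (x := 8e-4) (by norm_num) (by norm_num)
  have hb := log_le_num (T₀ := 1105000) (by norm_num) 13 (x := 0.0092) (by norm_num) (by norm_num)
  refine (tailH_le_num (T₀ := 1105000) (by norm_num) ha hb (by norm_num)).trans ?_
  norm_num

/-- **ROW S18 · `RH(T)`, any `T ≥ 1 105 000`, + the two θ-prints ⟹ Robin at every CA `N > 5040` with all primes `< ``4^18`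
(composed budgets `b'_k + d_k`; `X = 4^18 − 1`; `4¹⁸`: Part D `1.28·10⁶`, (ix-k) `1.32·10⁶`, tree `1.62·10⁶`). -/
theorem robinCA_below_stairS_1105000 (hB : Buthe2018_thm2_theta)
    (hK : BroadbentEtAl2021_theta_rel_1e19) {T : ℝ} (hT : 1105000 ≤ T) (hRH : RiemannHypothesisUpTo T) :
    robinCA_below 68719476736 := by
  have hT5 : (100000 : ℝ) ≤ T := le_trans (by norm_num) hT
  have ht0 := tailH_nonneg (show (7 : ℝ) ≤ T by linarith)
  have ht := (tailH_anti (by norm_num) hT).trans tailH_1105000_le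
  show robinCA_below (68719476735 + 1)
  refine robinCA_below_stairS hB hK hT5 hRH (X := 68719476735) (by norm_num) (fun k hk11 hk17 hfl => ?_)
    (fun k hk11 hk17 hkl hku => ?_)
  · interval_cases k <;> first
      | (exfalso; norm_num at hfl; done)
      | (refine ht.trans ?_; simp only [tolStS]; push_cast; norm_num)
  · interval_cases k <;> first
      | (exfalso; norm_num at hkl hku; done)
      | exact top_of_num ht0 ht (by norm_num) (s := 262144) (by norm_num) (by norm_num)
          (by simp only [L1, l2]; push_cast; norm_num) (by simp only [L1, l2, bkS, dk]; push_cast; norm_num)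

/-- `tailH(200000) ≤ 1.81097e-5`. -/
theorem tailH_200000_le :
    (Real.log (200000 / (2 * π)) + 1) / (π * 200000) + (184 + 30 * Real.log 200000) / 200000 ^ 2 ≤ 1.81097e-5 := by
  have ha := log_div_two_pi_le_num (T₀ := 200000) (by norm_num) 10 (x := 0.0037) (by norm_num) (by norm_num)
  have hb := log_le_num (T₀ := 200000) (by norm_num) 12 (x := 0.0021) (by norm_num) (by norm_num)
  refine (tailH_le_num (T₀ := 200000) (by norm_num) ha hb (by norm_num)).trans ?_
  norm_num

/-- **ROW SP200000 · `RH(T)`, any `T ≥ 200 000`, + the two θ-prints ⟹ Robin at every CA `N > 5040` with all primes `< ``2 400 000 001`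
(composed budgets `b'_k + d_k`; `X = 2 400 000 000`; Part D at `1.8·10⁵`: `4¹⁵ ≈ 1.07·10⁹`). -/
theorem robinCA_below_stairS_200000 (hB : Buthe2018_thm2_theta)
    (hK : BroadbentEtAl2021_theta_rel_1e19) {T : ℝ} (hT : 200000 ≤ T) (hRH : RiemannHypothesisUpTo T) :
    robinCA_below 2400000001 := by
  have hT5 : (100000 : ℝ) ≤ T := le_trans (by norm_num) hT
  have ht0 := tailH_nonneg (show (7 : ℝ) ≤ T by linarith)
  have ht := (tailH_anti (by norm_num) hT).trans tailH_200000_le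
  show robinCA_below (2400000000 + 1)
  refine robinCA_below_stairS hB hK hT5 hRH (X := 2400000000) (by norm_num) (fun k hk11 hk17 hfl => ?_)
    (fun k hk11 hk17 hkl hku => ?_)
  · interval_cases k <;> first
      | (exfalso; norm_num at hfl; done)
      | (refine ht.trans ?_; simp only [tolStS]; push_cast; norm_num)
  · interval_cases k <;> first
      | (exfalso; norm_num at hkl hku; done)
      | exact top_of_num ht0 ht (by norm_num) (s := 48990) (by norm_num) (by norm_num)
          (by simp only [L1, l2]; push_cast; norm_num) (by simp only [L1, l2, bkS, dk]; push_cast; norm_num)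

/-- `tailH(300000) ≤ 1.25053e-5`. -/
theorem tailH_300000_le :
    (Real.log (300000 / (2 * π)) + 1) / (π * 300000) + (184 + 30 * Real.log 300000) / 300000 ^ 2 ≤ 1.25053e-5 := by
  have ha := log_div_two_pi_le_num (T₀ := 300000) (by norm_num) 10 (x := 0.0078) (by norm_num) (by norm_num)
  have hb := log_le_num (T₀ := 300000) (by norm_num) 12 (x := 0.0062) (by norm_num) (by norm_num)
  refine (tailH_le_num (T₀ := 300000) (by norm_num) ha hb (by norm_num)).trans ?_
  norm_num

/-- **ROW SP300000 · `RH(T)`, any `T ≥ 300 000`, + the two θ-prints ⟹ Robin at every CA `N > 5040` with all primes `< ``5 700 000 001`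
(composed budgets `b'_k + d_k`; `X = 5 700 000 000`; Part D at `3.3·10⁵`: `4·10⁹`). -/
theorem robinCA_below_stairS_300000 (hB : Buthe2018_thm2_theta)
    (hK : BroadbentEtAl2021_theta_rel_1e19) {T : ℝ} (hT : 300000 ≤ T) (hRH : RiemannHypothesisUpTo T) :
    robinCA_below 5700000001 := by
  have hT5 : (100000 : ℝ) ≤ T := le_trans (by norm_num) hT
  have ht0 := tailH_nonneg (show (7 : ℝ) ≤ T by linarith)
  have ht := (tailH_anti (by norm_num) hT).trans tailH_300000_le
  show robinCA_below (5700000000 + 1)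
  refine robinCA_below_stairS hB hK hT5 hRH (X := 5700000000) (by norm_num) (fun k hk11 hk17 hfl => ?_)
    (fun k hk11 hk17 hkl hku => ?_)
  · interval_cases k <;> first
      | (exfalso; norm_num at hfl; done)
      | (refine ht.trans ?_; simp only [tolStS]; push_cast; norm_num)
  · interval_cases k <;> first
      | (exfalso; norm_num at hkl hku; done)
      | exact top_of_num ht0 ht (by norm_num) (s := 75499) (by norm_num) (by norm_num)
          (by simp only [L1, l2]; push_cast; norm_num) (by simp only [L1, l2, bkS, dk]; push_cast; norm_num)

/-- **ROW SP500000 · `RH(T)`, any `T ≥ 500 000`, + the two θ-prints ⟹ Robin at every CA `N > 5040` with all primes `< ``14 600 000 001`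
(composed budgets `b'_k + d_k`; `X = 14 600 000 000`; Part D at `5·10⁵`: `1.05·10¹⁰`; tree: `4¹⁶ ≈ 4.3·10⁹`). -/
theorem robinCA_below_stairS_500000 (hB : Buthe2018_thm2_theta)
    (hK : BroadbentEtAl2021_theta_rel_1e19) {T : ℝ} (hT : 500000 ≤ T) (hRH : RiemannHypothesisUpTo T) :
    robinCA_below 14600000001 := by
  have hT5 : (100000 : ℝ) ≤ T := le_trans (by norm_num) hT
  have ht0 := tailH_nonneg (show (7 : ℝ) ≤ T by linarith)
  have ht := (tailH_anti (by norm_num) hT).trans tailH_500000_le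
  show robinCA_below (14600000000 + 1)
  refine robinCA_below_stairS hB hK hT5 hRH (X := 14600000000) (by norm_num) (fun k hk11 hk17 hfl => ?_)
    (fun k hk11 hk17 hkl hku => ?_)
  · interval_cases k <;> first
      | (exfalso; norm_num at hfl; done)
      | (refine ht.trans ?_; simp only [tolStS]; push_cast; norm_num)
  · interval_cases k <;> first
      | (exfalso; norm_num at hkl hku; done)
      | exact top_of_num ht0 ht (by norm_num) (s := 120831) (by norm_num) (by norm_num)
          (by simp only [L1, l2]; push_cast; norm_num) (by simp only [L1, l2, bkS, dk]; push_cast; norm_num)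

/-- **ROW SP1000000 · `RH(T)`, any `T ≥ 1 000 000`, + the two θ-prints ⟹ Robin at every CA `N > 5040` with all primes `< ``57 200 000 001`
(composed budgets `b'_k + d_k`; `X = 57 200 000 000`; Part D at `10⁶`: `4.4·10¹⁰`; tree: `4¹⁷ ≈ 1.7·10¹⁰`). -/
theorem robinCA_below_stairS_1000000 (hB : Buthe2018_thm2_theta)
    (hK : BroadbentEtAl2021_theta_rel_1e19) {T : ℝ} (hT : 1000000 ≤ T) (hRH : RiemannHypothesisUpTo T) :
    robinCA_below 57200000001 := by
  have hT5 : (100000 : ℝ) ≤ T := le_trans (by norm_num) hT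
  have ht0 := tailH_nonneg (show (7 : ℝ) ≤ T by linarith)
  have ht := (tailH_anti (by norm_num) hT).trans tailH_1000000_le
  show robinCA_below (57200000000 + 1)
  refine robinCA_below_stairS hB hK hT5 hRH (X := 57200000000) (by norm_num) (fun k hk11 hk17 hfl => ?_)
    (fun k hk11 hk17 hkl hku => ?_)
  · interval_cases k <;> first
      | (exfalso; norm_num at hfl; done)
      | (refine ht.trans ?_; simp only [tolStS]; push_cast; norm_num)
  · interval_cases k <;> first
      | (exfalso; norm_num at hkl hku; done)
      | exact top_of_num ht0 ht (by norm_num) (s := 239166) (by norm_num) (by norm_num)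
          (by simp only [L1, l2]; push_cast; norm_num) (by simp only [L1, l2, bkS, dk]; push_cast; norm_num)

/-- **ROW S17″ · `RH(T)`, `T ≥ 5.5·10⁵` ⟹ Robin for every `5040 < n ≤ 10^(7·10⁹)`** (the range of the tree's `T ≥ 10⁶` row
`robin_le_of_rh6_refl` at `0.55×` the height; Part D: `0.64×`). -/
theorem robin_le_of_rh550000_stairS (hB : Buthe2018_thm2_theta)
    (hK : BroadbentEtAl2021_theta_rel_1e19) {T : ℝ} (hT : 550000 ≤ T) (hRH : RiemannHypothesisUpTo T) :
    ∀ n : ℕ, 5040 < n → n ≤ 10 ^ (7 * 10 ^ 9) → robinInequality n := by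
  have hRB : robinCA_below (17179869183 + 1) := robinCA_below_stairS_550000 hB hK hT hRH
  intro n hn hle
  have hn0 : 0 < n := lt_of_le_of_lt (Nat.zero_le 5040) hn
  have h1 : Real.log n ≤ ((7 * 10 ^ 9 : ℕ) : ℝ) * Real.log 10 := log_le_of_le_ten_pow hn0 hle
  clear hle
  refine robin_all_of_robinCA_below_low hB hK hRB (by norm_num) n hn ?_
  have h10 := RobinAnalytic.log_ten_lt
  have h9 : ((7 * 10 ^ 9 : ℕ) : ℝ) = 7e9 := by norm_num
  have hX : ((17179869183 : ℕ) : ℝ) = 17179869183 := by norm_num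
  rw [h9] at h1
  rw [hX]
  linarith

end StaircaseSqrt

end Summit.RiemannHypothesis.RiemannHypothesis.Theorems.Splittings.RobinFiniteC1

end
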